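import Summits.BirchSwinnertonDyer.BirchSwinnertonDyer.Theorems.PrintCf2RubinValueTwoTwistedKatoKummerLevels
import Summits.BirchSwinnertonDyer.BirchSwinnertonDyer.Theorems.PrintCf2RubinValueTwoRowTwoRelCoresKummer
import Summits.BirchSwinnertonDyer.BirchSwinnertonDyer.Theorems.PrintCf2RubinValueTwoRowTwoTwistedKummerConjTwist
import Summits.BirchSwinnertonDyer.BirchSwinnertonDyer.Theorems.PrintCf2RubinValueTwoKatoThetaNormChain
import Mathlib.Tactic.Group
import HarnessLib

/-!
# The EULER-FACTOR STEP across moduli: `cor_{K(𝔤𝔩)/K(𝔤)}(κ(z_{𝔤𝔩}) ⊗ t_θ) = (1 − θ(τ_𝔩⁻¹)·τ_𝔩)(κ(y_𝔤) ⊗ t_θ)` for `𝔩 ∤ 𝔤`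
# (de Shalit II.2.5 (i), branch `𝔩 ∤ 𝔣`, in twisted Kummer currency)

Cell `bsd-print-cf2`, WIDTH seat `bsd-line-cf2-p1-w5` g10 (prover-bsd-line-cf2-p1-w5-g10-0); piece (β4) of the levelwise arithmetic (LZ) behind hZC
(`TwistedZeta.hZC_of_levelwise`, p732796; split with -w2 g18, `HOME/STATUS` 16:37:48Z: -w5 = «II.2.5 ACROSS MODULI + assembly») on the DECIDING
child stmt-BirchSwinnertonDyer-24721; `--supports` 24721 (helper, Theses-free). THEOREMS ONLY (no definition, no named fact, no instance, no
`sorry`); CONDITIONAL where stated on the displayed print `DeShalit1987.prop25_i_normRelation` (II.2.5 (i)), carried as a hypothesis. The companion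
of -w2 g17's `KatoThetaNorm.algClosureEmb_normOver_step/_chain` (branch `𝔩 ∣ 𝔤`, p729xxx): here the OTHER branch, where the Euler factor appears.
HONEST FRAMING: bookkeeping over a published named fact plus generic twisted-Kummer cohomology; nothing closes the crux; no summit statement is proved
by this seat; BSD is not proved by any of this.

* §1 (generic) **`relCores_eq_sub_nsmul_levelConj_of_prod_smul_mul_smul_eq`** — `U′ ≤ U ⊴ Γ_K` open, `N_S ≤ U′`, `θ|_U = 1`; radicands `z` (at `U′`),
  `y` (fixed by `U`), roots `β_z^{p^k} = z`, `β_y^{p^k} = y`, classes `c_z` at `U′`, `c_y` at `U`; if `(∏ₓ s(x)·z) · (τ·y) = y` for a system of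
  representatives `s` of `U/U′` and some `τ ∈ Γ_K` (read: `N_{F′/F}(z) · τ(y) = y`), then **`cor_{U/U′}(c_z) = c_y − (θ(τ⁻¹) mod p^k)·(τ·c_y)`**
  (`cor ∘ Kummer = Kummer ∘ N` (-w6 g9), the twisted conjugation law `τ·c_y = (θ(τ) mod p^k)·(class of τβ_y)` (-w6 g10), product/inverse laws,
  root independence);
  and the factor-free twin `relCores_eq_of_prod_smul_eq` (`∏ₓ s(x)·z = y ⇒ cor(c_z) = c_y`, the `𝔩 ∣ 𝔤` branch / -w2 g17's chain in this currency);
* §2 (print) **`coe_normOver_mul_galFrob_symm_eq`** — de Shalit II.2.5 (i), `𝔩 ∤ 𝔤`, in Kato's normalisation at a RIGID level `𝔤` (`e = 1`), read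
  in `K̄`: `N_{K(𝔤𝔩)/K(𝔤)}(z) · σ_𝔩⁻¹(y) = y` for `ι̂ z = Θ(1; 𝔤𝔩, 𝔞)`, `ι̂ y = Θ(1; 𝔤, 𝔞)`;
* §3 `exists_smul_coe_eq_apply` — every `K`-automorphism of a subextension `E ⊆ K̄` is induced by some `τ ∈ Γ_K` (`AlgEquiv.liftNormal`), so §2
  feeds §1 with `τ` a lift of `σ_𝔩⁻¹`.

The Euler factor MULTIPLIES (Rubin → Kato direction): no inversion of `1 − Frob` is ever needed on the (β) side.

References: E. de Shalit (1987) II.2.4 (i), II.2.5 (i); J. Johnson-Leung, G. Kings (2011) §3.3 (5), Def. 3.5, Prop. 3.3 (2); K. Kato (2004)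
§15.5; J. Neukirch, A. Schmidt, K. Wingberg (2008) I §5.
-/

noncomputable section

open scoped Classical

-- the summit namespace `Summit.BirchSwinnertonDyer.BirchSwinnertonDyer` repeats the problem name by design (D-0017)
set_option linter.dupNamespace false
set_option autoImplicit false

open scoped NumberField
open Field IsDedekindDomain IntermediateField
open Literature.NumberTheory.NumberFields (rayClassField rayClassField_mono)
open Literature.NumberTheory.GaloisRepresentations Literature.NumberTheory.GaloisRepresentations.DiscreteGaloisModule
open Literature.NumberTheory.GaloisRepresentations.LocalWeilDatum
open Literature.NumberTheory.EllipticCurves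
open Literature.NumberTheory.ComplexMultiplication.EllipticUnits
open Literature.NumberTheory.ComplexMultiplication.EllipticUnits.JohnsonLeungKings2011
open Summit.BirchSwinnertonDyer.BirchSwinnertonDyer.Theorems.PrintCf2.RowTwo
open Summit.BirchSwinnertonDyer.BirchSwinnertonDyer.Theorems.PrintCf2.KatoThetaNorm

namespace Summit.BirchSwinnertonDyer.BirchSwinnertonDyer.Theorems.PrintCf2.TwistedZeta

/-! ## §1. The generic cohomological Euler step -/

section Generic

variable {K : Type} [Field K] [NumberField K] (p : ℕ) [Fact p.Prime] (S : Set (HeightOneSpectrum (𝓞 K)))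
  (θ : absoluteGaloisGroup K →ₜ* ℤ_[p]ˣ) (k : ℕ) {U U' : Subgroup (absoluteGaloisGroup K)}

/-- **`cor_{U/U′}(c_z) = c_y − (θ(τ⁻¹) mod p^k)·(τ·c_y)`** whenever `(∏ₓ s(x)·z)·(τ·y) = y` — the twisted-Kummer form of a norm relation
`N_{F′/F}(z) = y^{1 − τ}`: `cor(c_z)` is a class of `∏ₓ s(x)·β_z` (`cor ∘ Kummer = Kummer ∘ N`), `c_y − (class of τβ_y)` is a class of `β_y(τβ_y)⁻¹`,
the two radicands have the same `p^k`-th power, and `(class of τβ_y) = (θ(τ⁻¹) mod p^k)·(τ·c_y)` by the twisted conjugation law.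
[cite: JohnsonLeungKings2011, §3.3 (5) and Def. 3.5 (arXiv p0010:L61–80)] [cite: NeukirchSchmidtWingberg2008, I §5 Prop. 1.5.4, Cor. 1.5.7] [cite: deShalit1987, II.2.5 Proposition (i)] -/
theorem relCores_eq_sub_nsmul_levelConj_of_prod_smul_mul_smul_eq [U.Normal] (h : U' ≤ U) (hU : IsOpen (U : Set (absoluteGaloisGroup K)))
    (hU' : IsOpen (U' : Set (absoluteGaloisGroup K))) (hN : ramificationSubgroup K S ≤ U') (hθU : ∀ σ ∈ U, θ σ = 1)
    (hμN : ∀ τ ∈ ramificationSubgroup K S, ∀ ζ : (AlgebraicClosure K)ˣ, ζ ^ (p ^ k) = 1 → τ • ζ = ζ)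
    [Fintype (U ⧸ U'.subgroupOf U)] {s : U ⧸ U'.subgroupOf U → U} (hs : ∀ x, (s x : U ⧸ U'.subgroupOf U) = x)
    {z y βz βy : (AlgebraicClosure K)ˣ} (hβz : βz ^ (p ^ k) = z) (hβy : βy ^ (p ^ k) = y) (hyU : ∀ σ ∈ U, σ • y = y)
    (τ : absoluteGaloisGroup K) (hrel : (∏ x, ((s x : U) : absoluteGaloisGroup K) • z) * τ • y = y)
    {cz : levelCoh p S θ U' k 1} (hcz : IsTwistedKummerClass p θ S U' k βz cz)
    {cy : levelCoh p S θ U k 1} (hcy : IsTwistedKummerClass p θ S U k βy cy) :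
    relCores p S θ h hU hU' k 1 cz = cy - (charModPow p θ k τ⁻¹).val • levelConj p S θ U k 1 τ cy := by
  have hθN : ∀ n ∈ ramificationSubgroup K S, θ n = 1 := fun n hn ↦ hθU n (h (hN hn))
  -- `N_S` fixes `β_y`, hence `τβ_y`; `U` fixes `τy`
  have hβyN : ∀ n ∈ ramificationSubgroup K S, n • βy = βy := smul_eq_self_of_isTwistedKummerClass p θ (hN.trans h) hcy
  have hτβN : ∀ n ∈ ramificationSubgroup K S, n • τ • βy = τ • βy := by
    intro n hn
    have hconj : τ⁻¹ * n * τ ∈ ramificationSubgroup K S := (ramificationSubgroup_normal K S).conj_mem' n hn τ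
    rw [smul_smul, show n * τ = τ * (τ⁻¹ * n * τ) by group, mul_smul, hβyN _ hconj]
  have hτyU : ∀ σ ∈ U, (σ • (τ • βy) / (τ • βy)) ^ (p ^ k) = 1 := by
    intro σ hσ
    have hconj : τ⁻¹ * σ * τ ∈ U := (inferInstance : U.Normal).conj_mem' σ hσ τ
    rw [div_pow, ← smul_pow', ← smul_pow', hβy, smul_smul, show σ * τ = τ * (τ⁻¹ * σ * τ) by group, mul_smul, hyU _ hconj,
      div_self']
  -- a class `cτ` of `τβ_y` at `U`, and the conjugation law `τ·c_y = (θ(τ) mod p^k)·cτ`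
  obtain ⟨cτ, hcτ⟩ := exists_isTwistedKummerClass p S θ k U hU hθU hθN hμN (τ • βy) hτβN hτyU
  have hconj : levelConj p S θ U k 1 τ cy = (charModPow p θ k τ).val • cτ :=
    levelConj_eq_nsmul_of_isTwistedKummerClass p S θ U k hcy τ hcτ
  have hcancel : (charModPow p θ k τ⁻¹).val • levelConj p S θ U k 1 τ cy = cτ := by
    rw [hconj, ← mul_nsmul', ← natCast_zsmul, Nat.cast_mul, charModPow_apply, charModPow_apply, map_inv]
    exact zsmul_val_inv_mul_val_eq_self p k (nsmul_levelCoh_one_eq_zero p S θ U k cτ) (θ τ)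
  -- `cor(c_z)` is a class of `∏ₓ s(x)·β_z`; `c_y − cτ` one of `β_y (τβ_y)⁻¹`; same `p^k`-th powers
  have hrelc := isTwistedKummerClass_relCores p S θ k h hU hU' hN hθU hs hcz
  have hdiff : IsTwistedKummerClass p θ S U k (βy * (τ • βy)⁻¹) (cy + -cτ) :=
    isTwistedKummerClass_mul p S θ U k hcy (isTwistedKummerClass_inv p S θ k U hcτ)
  have hpow : (βy * (τ • βy)⁻¹) ^ (p ^ k) = (∏ x, ((s x : U) : absoluteGaloisGroup K) • βz) ^ (p ^ k) := by
    rw [mul_pow, inv_pow, ← smul_pow', hβy, ← Finset.prod_pow]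
    simp_rw [← smul_pow', hβz]
    exact (eq_mul_inv_of_mul_eq hrel).symm
  rw [eq_of_isTwistedKummerClass_of_pow_eq p S θ k U hθU hθN hμN hpow hrelc hdiff, ← hcancel, ← sub_eq_add_neg]

/-- **The factor-free branch in the same currency: `cor_{U/U′}(c_z) = c_y` whenever `∏ₓ s(x)·z = y`** (read: `N_{F′/F}(z) = y`, de Shalit II.2.5 (i)
for `𝔩 ∣ 𝔣`; -w2 g17's `KatoThetaNorm.algClosureEmb_normOver_step`): `cor(c_z)` and `c_y` are classes of radicands with the same `p^k`-th power.
[cite: JohnsonLeungKings2011, Def. 3.5 and Prop. 3.3 (2) (arXiv p0009:L122–p0010:L80)] [cite: NeukirchSchmidtWingberg2008, I §5 Cor. 1.5.7] [cite: deShalit1987, II.2.5 Proposition (i)] -/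
theorem relCores_eq_of_prod_smul_eq (h : U' ≤ U) (hU : IsOpen (U : Set (absoluteGaloisGroup K)))
    (hU' : IsOpen (U' : Set (absoluteGaloisGroup K))) (hN : ramificationSubgroup K S ≤ U') (hθU : ∀ σ ∈ U, θ σ = 1)
    (hμN : ∀ τ ∈ ramificationSubgroup K S, ∀ ζ : (AlgebraicClosure K)ˣ, ζ ^ (p ^ k) = 1 → τ • ζ = ζ)
    [Fintype (U ⧸ U'.subgroupOf U)] {s : U ⧸ U'.subgroupOf U → U} (hs : ∀ x, (s x : U ⧸ U'.subgroupOf U) = x)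
    {z y βz βy : (AlgebraicClosure K)ˣ} (hβz : βz ^ (p ^ k) = z) (hβy : βy ^ (p ^ k) = y)
    (hrel : ∏ x, ((s x : U) : absoluteGaloisGroup K) • z = y)
    {cz : levelCoh p S θ U' k 1} (hcz : IsTwistedKummerClass p θ S U' k βz cz)
    {cy : levelCoh p S θ U k 1} (hcy : IsTwistedKummerClass p θ S U k βy cy) :
    relCores p S θ h hU hU' k 1 cz = cy := by
  have hθN : ∀ n ∈ ramificationSubgroup K S, θ n = 1 := fun n hn ↦ hθU n (h (hN hn))
  have hpow : βy ^ (p ^ k) = (∏ x, ((s x : U) : absoluteGaloisGroup K) • βz) ^ (p ^ k) := by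
    rw [hβy, ← Finset.prod_pow]
    simp_rw [← smul_pow', hβz]
    exact hrel.symm
  exact eq_of_isTwistedKummerClass_of_pow_eq p S θ k U hθU hθN hμN hpow (isTwistedKummerClass_relCores p S θ k h hU hU' hN hθU hs hcz) hcy

end Generic

/-! ## §2. de Shalit II.2.5 (i), branch `𝔩 ∤ 𝔤`, in Kato's normalisation (rigid level) -/

section Print

variable {K : Type} [Field K] [NumberField K]

/-- **ONE PRIME STEP, FROBENIUS BRANCH (de Shalit II.2.5 (i), `𝔩 ∤ 𝔤`, exponent `1`)**: `K` imaginary quadratic, a rigid level `𝔤 ≠ 0, O_K`, a prime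
`𝔩 ∤ 𝔤`, `𝔞 ≠ 0` prime to `𝔤𝔩`, period pairs with lattices `ι(𝔤)`, `ι(𝔤𝔩)` (plus `𝔞⁻¹`, representatives), `y ∈ K(𝔤)` with `ι̂ y = Θ(1; 𝔤, 𝔞)`, `z ∈ K(𝔤𝔩)`
with `ι̂ z = Θ(1; 𝔤𝔩, 𝔞)`: read in `K̄`, **`N_{K(𝔤𝔩)/K(𝔤)}(z) · σ_𝔩⁻¹(y) = y`** (`σ_𝔩 = galFrob K K(𝔤) 𝔩`), i.e. `N(z) = y^{1 − σ_𝔩⁻¹}`.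
[cite: deShalit1987, II.2.5 Proposition (i)] [cite: Kato2004Asterisque, §15.5 (p. 253)] -/
theorem coe_normOver_mul_galFrob_symm_eq (h25 : DeShalit1987.prop25_i_normRelation) (hK : IsImaginaryQuadratic K)
    (ι : K →+* ℂ) {𝔤 : Ideal (𝓞 K)} (𝔩 : HeightOneSpectrum (𝓞 K)) (h𝔤0 : 𝔤 ≠ ⊥) (h𝔤1 : 𝔤 ≠ ⊤)
    (hrig : UnitsInjectiveMod 𝔤) (hndvd : ¬ 𝔩.asIdeal ∣ 𝔤) {𝔞 : Ideal (𝓞 K)} (h𝔞0 : 𝔞 ≠ ⊥)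
    (h𝔞c : IsCoprime 𝔞 (𝔤 * 𝔩.asIdeal))
    {L La : PeriodPair} {S : Finset ℂ} (hL : ∀ z : ℂ, z ∈ L.lattice ↔ ∃ a ∈ 𝔤, z = ι (a : K))
    (hLa : La.lattice = idealInvLattice ι 𝔞 L.lattice) (hS : L.IsLatticeReps La S)
    {L' La' : PeriodPair} {S' : Finset ℂ} (hL' : ∀ z : ℂ, z ∈ L'.lattice ↔ ∃ a ∈ 𝔤 * 𝔩.asIdeal, z = ι (a : K))
    (hLa' : La'.lattice = idealInvLattice ι 𝔞 L'.lattice) (hS' : L'.IsLatticeReps La' S')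
    {y : AlgebraicClosure K} (hy : y ∈ rayClassField K 𝔤) (hyθ : algClosureEmb ι y = L.deShalitTheta La S 1)
    {z : AlgebraicClosure K} (hz : z ∈ rayClassField K (𝔤 * 𝔩.asIdeal))
    (hzθ : algClosureEmb ι z = L'.deShalitTheta La' S' 1) :
    ((normOver (rayClassField K (𝔤 * 𝔩.asIdeal)) (rayClassField K 𝔤) ⟨z, hz⟩ : rayClassField K (𝔤 * 𝔩.asIdeal)) :
        AlgebraicClosure K) * (((galFrob K (rayClassField K 𝔤) 𝔩).symm ⟨y, hy⟩ : rayClassField K 𝔤) : AlgebraicClosure K) = y := by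
  have hCM : IsCMLattice ι L.lattice := isCMLattice_of_mem_iff hL
  have hprim : IsPrimitiveDivisionPoint ι 𝔤 L.lattice 1 := isPrimitiveDivisionPoint_one_of_mem_iff hL
  have hprim' : IsPrimitiveDivisionPoint ι (𝔤 * 𝔩.asIdeal) L'.lattice 1 := isPrimitiveDivisionPoint_one_of_mem_iff hL'
  have hLl : L'.lattice = idealMulLattice ι 𝔩.asIdeal L.lattice := by
    ext w
    rw [hL' w, mem_idealMulLattice_iff_of_mem_iff hL, mul_comm]
  have key := (h25 K hK ι L La L' La' S S' 𝔤 𝔞 𝔩 1 ⟨z, hz⟩ ⟨y, hy⟩ hCM h𝔤0 h𝔤1 hprim h𝔞0 h𝔞c hLa hS hLl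
    hprim' hLa' hS' hzθ hyθ).2 hndvd
  rw [exponent_eq_one hrig, pow_one, relNorm_eq_normOver, ← hyθ, ← map_mul] at key
  exact (algClosureEmb ι).injective key

/-! ## §3. Automorphisms of a subextension are induced from `Γ_K` -/

omit [NumberField K] in
/-- Every `K`-automorphism `χ` of a subextension `E ⊆ K̄` is induced by some `τ ∈ Γ_K`: `τ·x = χ(x)` for all `x ∈ E` (`AlgEquiv.liftNormal`).
[cite: NeukirchANT1999, Ch. IV §1 (infinite Galois theory)] -/
theorem exists_smul_coe_eq_apply (E : IntermediateField K (AlgebraicClosure K)) (χ : E ≃ₐ[K] E) :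
    ∃ τ : absoluteGaloisGroup K, ∀ x : E, τ • (x : AlgebraicClosure K) = ((χ x : E) : AlgebraicClosure K) :=
  ⟨χ.liftNormal (AlgebraicClosure K), fun x ↦ χ.liftNormal_commutes (AlgebraicClosure K) x⟩

/-- **The Frobenius branch with a Galois lift**: under the hypotheses of `coe_normOver_mul_galFrob_symm_eq` there is `τ ∈ Γ_K` inducing `σ_𝔩⁻¹` on
`K(𝔤)` with `N_{K(𝔤𝔩)/K(𝔤)}(z) · τ(y) = y` in `K̄` — the shape consumed by §1. [cite: deShalit1987, II.2.5 Proposition (i)] [cite: Kato2004Asterisque, §15.5 (p. 253)] -/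
theorem exists_smul_coe_normOver_mul_smul_eq (h25 : DeShalit1987.prop25_i_normRelation) (hK : IsImaginaryQuadratic K)
    (ι : K →+* ℂ) {𝔤 : Ideal (𝓞 K)} (𝔩 : HeightOneSpectrum (𝓞 K)) (h𝔤0 : 𝔤 ≠ ⊥) (h𝔤1 : 𝔤 ≠ ⊤)
    (hrig : UnitsInjectiveMod 𝔤) (hndvd : ¬ 𝔩.asIdeal ∣ 𝔤) {𝔞 : Ideal (𝓞 K)} (h𝔞0 : 𝔞 ≠ ⊥)
    (h𝔞c : IsCoprime 𝔞 (𝔤 * 𝔩.asIdeal))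
    {L La : PeriodPair} {S : Finset ℂ} (hL : ∀ z : ℂ, z ∈ L.lattice ↔ ∃ a ∈ 𝔤, z = ι (a : K))
    (hLa : La.lattice = idealInvLattice ι 𝔞 L.lattice) (hS : L.IsLatticeReps La S)
    {L' La' : PeriodPair} {S' : Finset ℂ} (hL' : ∀ z : ℂ, z ∈ L'.lattice ↔ ∃ a ∈ 𝔤 * 𝔩.asIdeal, z = ι (a : K))
    (hLa' : La'.lattice = idealInvLattice ι 𝔞 L'.lattice) (hS' : L'.IsLatticeReps La' S')
    {y : AlgebraicClosure K} (hy : y ∈ rayClassField K 𝔤) (hyθ : algClosureEmb ι y = L.deShalitTheta La S 1)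
    {z : AlgebraicClosure K} (hz : z ∈ rayClassField K (𝔤 * 𝔩.asIdeal))
    (hzθ : algClosureEmb ι z = L'.deShalitTheta La' S' 1) :
    ∃ τ : absoluteGaloisGroup K, (∀ x : rayClassField K 𝔤,
        τ • (x : AlgebraicClosure K) = (((galFrob K (rayClassField K 𝔤) 𝔩).symm x : rayClassField K 𝔤) : AlgebraicClosure K)) ∧
      ((normOver (rayClassField K (𝔤 * 𝔩.asIdeal)) (rayClassField K 𝔤) ⟨z, hz⟩ : rayClassField K (𝔤 * 𝔩.asIdeal)) :
        AlgebraicClosure K) * τ • y = y := by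
  obtain ⟨τ, hτ⟩ := exists_smul_coe_eq_apply (rayClassField K 𝔤) (galFrob K (rayClassField K 𝔤) 𝔩).symm
  refine ⟨τ, hτ, ?_⟩
  have e : τ • y = (((galFrob K (rayClassField K 𝔤) 𝔩).symm ⟨y, hy⟩ : rayClassField K 𝔤) : AlgebraicClosure K) := hτ ⟨y, hy⟩
  have key := coe_normOver_mul_galFrob_symm_eq h25 hK ι 𝔩 h𝔤0 h𝔤1 hrig hndvd h𝔞0 h𝔞c hL hLa hS hL' hLa' hS' hy hyθ hz hzθ
  rw [← e] at key
  exact key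

end Print

end Summit.BirchSwinnertonDyer.BirchSwinnertonDyer.Theorems.PrintCf2.TwistedZeta

end
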